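import Summits.Ventures.PercRepro.RankLevelSetPlaneSix

/-!
# PercRepro — covers by relative flats and the PRIME-HYPERPLANE LEMMA on the `e`-free core (night-1, gen 3)

`proofs/NIGHT-1-C025-induction.md` §14.21 (mine-4's F4-PROOF.md (K4), in the Set form of `RankLevelSetPlaneSix`, coloops
allowed). For `G ⊆ E` a set `H ⊆ G` is `G`-CLOSED (`GClosed M G H`) if `cl(H) ∩ G ⊆ H` — the flats of the restriction to
`G`. Every `x ∈ G` has a COVER by two `G`-closed sets avoiding `x` (`exists_cover_of_free`: the two sides of an `x`-free
partition, closed inside `G`). A `G`-closed `H` is PRIME if it is not the union of two proper `G`-closed subsets.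

* **`exists_cover_of_free`**, **`notMem_closure_of_gclosed`**, **`eRk_lt_of_gclosed_ssubset`** — the relative-flat toolkit;
* **`indep_insert_of_prime_cover`** — (K4): if `x ∈ G` has a cover `(H₁, H₂)` with `H₁` prime and `r(G) ≤ r(H₁) + 1`, then
  `{x} ∪ ((G ∖ {x}) ∖ H₁)` is independent; hence **`ncard_le_of_prime_cover`**: `|G| ≤ |H₁| + r(G)`.
Axioms: standard.
-/

open scoped Matroid

namespace PercRepro

namespace ThmN

open Set

variable {α : Type}

/-- `H` is closed inside `G`: a flat of the restriction to `G`. -/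
def GClosed (M : Matroid α) (G H : Set α) : Prop := H ⊆ G ∧ M.closure H ∩ G ⊆ H

/-- `H` is prime in `G`: not the union of two proper `G`-closed subsets. -/
def GPrime (M : Matroid α) (G H : Set α) : Prop :=
  ∀ A B : Set α, GClosed M G A → GClosed M G B → A ⊆ H → B ⊆ H → H ⊆ A ∪ B → A = H ∨ B = H

/-- A `G`-closed set avoiding a point of `G` has that point outside its closure. -/
theorem notMem_closure_of_gclosed {M : Matroid α} {G H : Set α} (hH : GClosed M G H) {x : α} (hx : x ∈ G)
    (hxH : x ∉ H) : x ∉ M.closure H := fun h => hxH (hH.2 ⟨h, hx⟩)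

/-- The intersection of two `G`-closed sets is `G`-closed. -/
theorem GClosed.inter {M : Matroid α} {G A B : Set α} (hA : GClosed M G A) (hB : GClosed M G B) :
    GClosed M G (A ∩ B) :=
  ⟨Set.inter_subset_left.trans hA.1, fun _ hy =>
    ⟨hA.2 ⟨M.closure_subset_closure Set.inter_subset_left hy.1, hy.2⟩,
     hB.2 ⟨M.closure_subset_closure Set.inter_subset_right hy.1, hy.2⟩⟩⟩

/-- `cl(S) ∩ G` is `G`-closed. -/
theorem gclosed_closure_inter (M : Matroid α) (G S : Set α) : GClosed M G (M.closure S ∩ G) :=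
  ⟨Set.inter_subset_right, fun _ hy =>
    ⟨by
      have : M.closure (M.closure S ∩ G) ⊆ M.closure S :=
        (M.closure_subset_closure Set.inter_subset_left).trans (by rw [M.closure_closure])
      exact this hy.1, hy.2⟩⟩

/-- **Covers**: every `x ∈ G ⊆ E` has two `G`-closed sets avoiding `x` that cover `G ∖ {x}`. -/
theorem exists_cover_of_free (M : Matroid α)
    (hfree : ∀ e ∈ M.E, ∃ A ⊆ M.E \ {e}, e ∉ M.closure A ∧ e ∉ M.closure ((M.E \ {e}) \ A))
    {G : Set α} (hG : G ⊆ M.E) {x : α} (hx : x ∈ G) :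
    ∃ H₁ H₂ : Set α, GClosed M G H₁ ∧ GClosed M G H₂ ∧ x ∉ H₁ ∧ x ∉ H₂ ∧ G \ {x} ⊆ H₁ ∪ H₂ := by
  obtain ⟨A, hA, hxA, hxB⟩ := hfree x (hG hx)
  refine ⟨M.closure A ∩ G, M.closure ((M.E \ {x}) \ A) ∩ G, gclosed_closure_inter M G A,
    gclosed_closure_inter M G _, fun h => hxA h.1, fun h => hxB h.1, ?_⟩
  intro y hy
  have hyE : y ∈ M.E \ {x} := ⟨hG hy.1, hy.2⟩
  by_cases hyA : y ∈ A
  · exact Or.inl ⟨M.subset_closure A (hA.trans Set.sdiff_subset) hyA, hy.1⟩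
  · exact Or.inr ⟨M.subset_closure _ (Set.sdiff_subset.trans Set.sdiff_subset) ⟨hyE, hyA⟩, hy.1⟩

/-- A proper `G`-closed subset of `G` has smaller rank than `G` (finite ranks). -/
theorem eRk_lt_of_gclosed_ssubset (M : Matroid α) [M.Finite] {G H : Set α} (hG : G ⊆ M.E)
    (hH : GClosed M G H) {y : α} (hy : y ∈ G) (hyH : y ∉ H) : M.eRk H < M.eRk G := by
  have hGfin : G.Finite := M.ground_finite.subset hG
  rcases lt_or_ge (M.eRk H) (M.eRk G) with h | h
  · exact h
  · exfalso
    have hsub : G ⊆ M.closure H := subset_closure_of_eRk_le M hH.1 hG hGfin h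
    exact hyH (hH.2 ⟨hsub hy, hy⟩)

/-- **(K4) THE PRIME-HYPERPLANE LEMMA**: if `x ∈ G` has a cover `(H₁, H₂)` by `G`-closed sets avoiding `x`, `H₁` is prime
in `G` and `r(G) ≤ r(H₁) + 1`, then `{x} ∪ ((G ∖ {x}) ∖ H₁)` is independent. -/
theorem indep_insert_of_prime_cover (M : Matroid α) [M.Finite]
    (hfree : ∀ e ∈ M.E, ∃ A ⊆ M.E \ {e}, e ∉ M.closure A ∧ e ∉ M.closure ((M.E \ {e}) \ A))
    {G H₁ H₂ : Set α} (hG : G ⊆ M.E) {x : α} (hx : x ∈ G)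
    (hH₁ : GClosed M G H₁) (hH₂ : GClosed M G H₂) (hxH₁ : x ∉ H₁) (hxH₂ : x ∉ H₂)
    (hcov : G \ {x} ⊆ H₁ ∪ H₂) (hprime : GPrime M G H₁) (hrk : M.eRk G ≤ M.eRk H₁ + 1) :
    M.Indep (insert x ((G \ {x}) \ H₁)) := by
  set T := (G \ {x}) \ H₁ with hT
  have hTG : T ⊆ G := Set.sdiff_subset.trans Set.sdiff_subset
  have hTH₂ : T ⊆ H₂ := by
    intro y hy
    rcases hcov hy.1 with h | h
    · exact absurd h hy.2
    · exact h
  have hIE : insert x T ⊆ M.E := Set.insert_subset (hG hx) (hTG.trans hG)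
  rw [Matroid.indep_iff_forall_notMem_closure_sdiff hIE]
  intro e he
  rcases he with rfl | heT
  · -- `x ∉ cl(T)` since `T ⊆ H₂` and `H₂` is `G`-closed avoiding `x`
    have h1 : (insert e T) \ {e} ⊆ H₂ := by
      intro y hy
      rcases hy.1 with rfl | hyT
      · exact absurd rfl hy.2
      · exact hTH₂ hyT
    exact fun h => notMem_closure_of_gclosed hH₂ hx hxH₂ (M.closure_subset_closure h1 h)
  · -- `y ∈ T`: its cover `(G₁, G₂)`; primality forces `G₁ = H₁`, so `G₂ ⊇ (T ∖ {y}) ∪ {x}` and `y ∉ cl(G₂)`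
    have hyG : e ∈ G := heT.1.1
    have hyx : e ≠ x := fun h => heT.1.2 h
    have hyH₁ : e ∉ H₁ := heT.2
    obtain ⟨G₁, G₂, hG₁, hG₂, heG₁, heG₂, hcov'⟩ := exists_cover_of_free M hfree hG hyG
    have hH₁cov : H₁ ⊆ (G₁ ∩ H₁) ∪ (G₂ ∩ H₁) := by
      intro z hz
      have hzG : z ∈ G \ {e} := ⟨hH₁.1 hz, fun h => hyH₁ (h ▸ hz)⟩
      rcases hcov' hzG with h | h
      · exact Or.inl ⟨h, hz⟩
      · exact Or.inr ⟨h, hz⟩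
    -- one side of the trace is `H₁`; that side is then `H₁` itself by the rank bound
    have key : ∀ G' : Set α, GClosed M G G' → e ∉ G' → H₁ ⊆ G' → G' = H₁ := by
      intro G' hG' heG' hsub
      have hlt := eRk_lt_of_gclosed_ssubset M hG hG' hyG heG'
      have hle : M.eRk G' ≤ M.eRk H₁ := by
        have h1 : M.eRk G' < M.eRk H₁ + 1 := lt_of_lt_of_le hlt hrk
        exact Order.le_of_lt_add_one h1
      have hG'fin : G'.Finite := M.ground_finite.subset (hG'.1.trans hG)
      have hsub' : G' ⊆ M.closure H₁ := subset_closure_of_eRk_le M hsub (hG'.1.trans hG) hG'fin hle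
      exact Set.Subset.antisymm (fun z hz => hH₁.2 ⟨hsub' hz, hG'.1 hz⟩) hsub
    have hother : ∃ G' : Set α, GClosed M G G' ∧ e ∉ G' ∧ (G \ {e}) \ H₁ ⊆ G' := by
      rcases hprime (G₁ ∩ H₁) (G₂ ∩ H₁) (hG₁.inter hH₁) (hG₂.inter hH₁) Set.inter_subset_right
          Set.inter_subset_right hH₁cov with h | h
      · have hG₁H : G₁ = H₁ := key G₁ hG₁ heG₁ (fun z hz => by
          have hz' : z ∈ G₁ ∩ H₁ := by rw [h]; exact hz
          exact hz'.1)
        refine ⟨G₂, hG₂, heG₂, ?_⟩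
        intro z hz
        rcases hcov' hz.1 with h' | h'
        · exact absurd (hG₁H ▸ h') hz.2
        · exact h'
      · have hG₂H : G₂ = H₁ := key G₂ hG₂ heG₂ (fun z hz => by
          have hz' : z ∈ G₂ ∩ H₁ := by rw [h]; exact hz
          exact hz'.1)
        refine ⟨G₁, hG₁, heG₁, ?_⟩
        intro z hz
        rcases hcov' hz.1 with h' | h'
        · exact h'
        · exact absurd (hG₂H ▸ h') hz.2
    obtain ⟨G', hG', heG', hsubG'⟩ := hother
    have h1 : (insert x T) \ {e} ⊆ G' := by
      intro z hz
      rcases hz.1 with rfl | hzT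
      · exact hsubG' ⟨⟨hx, fun h => hyx (h.symm ▸ rfl)⟩, hxH₁⟩
      · exact hsubG' ⟨⟨hzT.1.1, hz.2⟩, hzT.2⟩
    exact fun h => notMem_closure_of_gclosed hG' hyG heG' (M.closure_subset_closure h1 h)

/-- **`|G| ≤ |H₁| + r(G)`** under the hypotheses of the prime-hyperplane lemma. -/
theorem ncard_le_of_prime_cover (M : Matroid α) [M.Finite]
    (hfree : ∀ e ∈ M.E, ∃ A ⊆ M.E \ {e}, e ∉ M.closure A ∧ e ∉ M.closure ((M.E \ {e}) \ A))
    {G H₁ H₂ : Set α} (hG : G ⊆ M.E) {x : α} (hx : x ∈ G)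
    (hH₁ : GClosed M G H₁) (hH₂ : GClosed M G H₂) (hxH₁ : x ∉ H₁) (hxH₂ : x ∉ H₂)
    (hcov : G \ {x} ⊆ H₁ ∪ H₂) (hprime : GPrime M G H₁) (hrk : M.eRk G ≤ M.eRk H₁ + 1) {r : ℕ}
    (hr : M.eRk G ≤ r) : G.ncard ≤ H₁.ncard + r := by
  have hI := indep_insert_of_prime_cover M hfree hG hx hH₁ hH₂ hxH₁ hxH₂ hcov hprime hrk
  have hGfin : G.Finite := M.ground_finite.subset hG
  set T := (G \ {x}) \ H₁ with hT
  have hTfin : T.Finite := hGfin.subset (Set.sdiff_subset.trans Set.sdiff_subset)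
  have hIsub : insert x T ⊆ G := Set.insert_subset hx (Set.sdiff_subset.trans Set.sdiff_subset)
  have hIcard : (insert x T).encard ≤ M.eRk G := hI.encard_le_eRk_of_subset hIsub
  have hxT : x ∉ T := fun h => h.1.2 rfl
  have hIfin : (insert x T).Finite := hTfin.insert x
  have hcardI : (insert x T).ncard = T.ncard + 1 := Set.ncard_insert_of_notMem hxT hTfin
  have hIr : (insert x T).ncard ≤ r := by
    have h : ((insert x T).ncard : ℕ∞) ≤ r := by rw [hIfin.cast_ncard_eq]; exact hIcard.trans hr
    exact_mod_cast h
  have hsplit : G.ncard ≤ (G \ {x}).ncard + 1 := by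
    have := Set.ncard_sdiff_singleton_add_one hx hGfin
    omega
  have hsplit2 : (G \ {x}).ncard ≤ T.ncard + H₁.ncard := by
    have hH₁fin : H₁.Finite := hGfin.subset hH₁.1
    calc (G \ {x}).ncard ≤ ((G \ {x}) \ H₁).ncard + H₁.ncard :=
          Set.ncard_le_ncard_sdiff_add_ncard _ _ hH₁fin
      _ = T.ncard + H₁.ncard := rfl
  omega

/-- Primality is intrinsic: for a `G`-closed `H`, the `G`-closed subsets of `H` are exactly its `H`-closed subsets, so
`GPrime M H H → GPrime M G H`. -/
theorem gprime_of_self {M : Matroid α} {G H : Set α} (hH : GClosed M G H) (hp : GPrime M H H) : GPrime M G H := by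
  intro A B hA hB hAH hBH hcov
  have hA' : GClosed M H A := ⟨hAH, fun y hy => hA.2 ⟨hy.1, hH.1 hy.2⟩⟩
  have hB' : GClosed M H B := ⟨hBH, fun y hy => hB.2 ⟨hy.1, hH.1 hy.2⟩⟩
  exact hp A B hA' hB' hAH hBH hcov

/-- Two distinct `P`-closed sets of rank `≤ 2` with `3` points each share at most one point (two points span the
line, and a rank-`≤ 2` set has `≤ 3` points). -/
theorem ncard_inter_le_one_of_lines (M : Matroid α) [M.Finite]
    (hfree : ∀ e ∈ M.E, ∃ A ⊆ M.E \ {e}, e ∉ M.closure A ∧ e ∉ M.closure ((M.E \ {e}) \ A))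
    {P m m' : Set α} (hP : P ⊆ M.E) (hm : GClosed M P m) (hm' : GClosed M P m') (hrm : M.eRk m ≤ 2)
    (hrm' : M.eRk m' ≤ 2) (hm3 : m.ncard = 3) (hm'3 : m'.ncard = 3) (hne : m ≠ m') : (m ∩ m').ncard ≤ 1 := by
  by_contra h
  push Not at h
  have hmE : m ⊆ M.E := hm.1.trans hP
  have hm'E : m' ⊆ M.E := hm'.1.trans hP
  have hPfin : P.Finite := M.ground_finite.subset hP
  have hmfin : m.Finite := hPfin.subset hm.1
  have hm'fin : m'.Finite := hPfin.subset hm'.1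
  have hint : (2 : ℕ∞) ≤ M.eRk (m ∩ m') :=
    two_le_eRk_of_two_le_ncard_of_free M hfree (Set.inter_subset_left.trans hmE) h
  have hsub := M.eRk_inter_add_eRk_union_le m m'
  have hun : M.eRk (m ∪ m') ≤ 2 := by
    have h4 : M.eRk (m ∩ m') + M.eRk (m ∪ m') ≤ (2 : ℕ∞) + 2 := hsub.trans (add_le_add hrm hrm')
    have h5 : (2 : ℕ∞) + M.eRk (m ∪ m') ≤ 2 + 2 := by
      calc (2 : ℕ∞) + M.eRk (m ∪ m') ≤ M.eRk (m ∩ m') + M.eRk (m ∪ m') := by gcongr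
        _ ≤ 2 + 2 := h4
    exact (ENat.add_le_add_iff_left (by simp)).1 h5
  have hun3 : (m ∪ m').ncard ≤ 3 := by
    have := ncard_add_one_le_two_pow_of_eRk_le M (not_isLoop_of_free M hfree) hfree 2 (m ∪ m')
      (Set.union_subset hmE hm'E) hun
    omega
  have heq : m ∪ m' = m := by
    apply (Set.eq_of_subset_of_ncard_le Set.subset_union_left ?_ (hmfin.union hm'fin)).symm
    omega
  have hm'm : m' ⊆ m := by rw [← heq]; exact Set.subset_union_right
  exact hne (Set.eq_of_subset_of_ncard_le hm'm (by omega) hmfin).symm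

/-- **(K2′) A 6-POINT PLANE OF THE `e`-FREE CORE IS PRIME**: a set `P ⊆ E` of rank `≤ 3` with `6` points is not the union
of two proper `P`-closed subsets. -/
theorem gprime_of_six (M : Matroid α) [M.Finite]
    (hfree : ∀ e ∈ M.E, ∃ A ⊆ M.E \ {e}, e ∉ M.closure A ∧ e ∉ M.closure ((M.E \ {e}) \ A))
    {P : Set α} (hP : P ⊆ M.E) (hr : M.eRk P ≤ 3) (h6 : P.ncard = 6) : GPrime M P P := by
  intro A B hA hB hAP hBP hcov
  by_contra hne
  push Not at hne
  obtain ⟨hAne, hBne⟩ := hne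
  have hPfin : P.Finite := M.ground_finite.subset hP
  -- proper `P`-closed subsets have rank `≤ 2`, hence `≤ 3` points
  have hproper : ∀ C : Set α, GClosed M P C → C ≠ P → M.eRk C ≤ 2 ∧ C.ncard ≤ 3 := by
    intro C hC hCne
    obtain ⟨y, hyP, hyC⟩ : ∃ y ∈ P, y ∉ C := by
      by_contra hall
      push Not at hall
      exact hCne (Set.Subset.antisymm hC.1 hall)
    have hlt := eRk_lt_of_gclosed_ssubset M hP hC hyP hyC
    have hr2 : M.eRk C ≤ 2 := by
      have h1 : M.eRk C < (3 : ℕ∞) := lt_of_lt_of_le hlt hr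
      have h3 : (3 : ℕ∞) = 2 + 1 := by norm_num
      rw [h3] at h1
      exact Order.le_of_lt_add_one h1
    refine ⟨hr2, ?_⟩
    have := ncard_add_one_le_two_pow_of_eRk_le M (not_isLoop_of_free M hfree) hfree 2 C (hC.1.trans hP) hr2
    omega
  obtain ⟨hrA, hA3⟩ := hproper A hA hAne
  obtain ⟨hrB, hB3⟩ := hproper B hB hBne
  have hAfin : A.Finite := hPfin.subset hAP
  have hBfin : B.Finite := hPfin.subset hBP
  -- both sides have exactly `3` points and are disjoint
  have hcard : 6 ≤ A.ncard + B.ncard := by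
    calc 6 = P.ncard := h6.symm
      _ ≤ (A ∪ B).ncard := Set.ncard_le_ncard hcov (hAfin.union hBfin)
      _ ≤ A.ncard + B.ncard := Set.ncard_union_le A B
  have hA3' : A.ncard = 3 := by omega
  have hB3' : B.ncard = 3 := by omega
  have hdisj : (A ∩ B).ncard = 0 := by
    have := Set.ncard_inter_add_ncard_union A B hAfin hBfin
    have h6' : P.ncard ≤ (A ∪ B).ncard := Set.ncard_le_ncard hcov (hAfin.union hBfin)
    have h2 : (A ∪ B).ncard ≤ 6 := by
      calc (A ∪ B).ncard ≤ P.ncard := Set.ncard_le_ncard (Set.union_subset hAP hBP) hPfin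
        _ = 6 := h6
    omega
  -- a point `x ∈ A` and its cover inside `P`
  obtain ⟨x, hxA⟩ : A.Nonempty := by
    rw [Set.nonempty_iff_ne_empty]; intro h; rw [h] at hA3'; simp at hA3'
  have hxP : x ∈ P := hAP hxA
  obtain ⟨H₁, H₂, hH₁, hH₂, hxH₁, hxH₂, hcov'⟩ := exists_cover_of_free M hfree hP hxP
  have hH₁ne : H₁ ≠ P := fun h => hxH₁ (h ▸ hxP)
  have hH₂ne : H₂ ≠ P := fun h => hxH₂ (h ▸ hxP)
  obtain ⟨hrH₁, hH₁3⟩ := hproper H₁ hH₁ hH₁ne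
  obtain ⟨hrH₂, hH₂3⟩ := hproper H₂ hH₂ hH₂ne
  have hH₁fin : H₁.Finite := hPfin.subset hH₁.1
  have hH₂fin : H₂.Finite := hPfin.subset hH₂.1
  have h5 : 5 ≤ H₁.ncard + H₂.ncard := by
    have h1 : (P \ {x}).ncard + 1 = P.ncard := Set.ncard_sdiff_singleton_add_one hxP hPfin
    calc 5 = (P \ {x}).ncard := by omega
      _ ≤ (H₁ ∪ H₂).ncard := Set.ncard_le_ncard hcov' (hH₁fin.union hH₂fin)
      _ ≤ H₁.ncard + H₂.ncard := Set.ncard_union_le _ _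
  -- a `3`-point side `m` of the cover of `x`
  have hside : ∀ m : Set α, GClosed M P m → x ∉ m → M.eRk m ≤ 2 → m.ncard = 3 →
      P \ {x} ⊆ m ∪ (if m = H₁ then H₂ else H₁) → False := by
    intro m hm hxm hrm hm3 hcovm
    -- `m ≠ A` (it avoids `x ∈ A`)
    have hmA : m ≠ A := fun h => hxm (h ▸ hxA)
    -- `m ≠ B`: else the other side contains `A ∖ {x}`, two points of `A`, hence `A ∋ x`
    have hmB : m ≠ B := by
      intro hmB
      set H' := if m = H₁ then H₂ else H₁ with hH'
      have hH'cl : GClosed M P H' := by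
        by_cases h : m = H₁
        · simp only [hH', if_pos h]; exact hH₂
        · simp only [hH', if_neg h]; exact hH₁
      have hxH' : x ∉ H' := by
        by_cases h : m = H₁
        · simp only [hH', if_pos h]; exact hxH₂
        · simp only [hH', if_neg h]; exact hxH₁
      have hsub : A \ {x} ⊆ H' := by
        intro y hy
        have hyP : y ∈ P \ {x} := ⟨hAP hy.1, hy.2⟩
        rcases hcovm hyP with h | h
        · exfalso
          have : y ∈ A ∩ B := ⟨hy.1, hmB ▸ h⟩
          have hne' : (A ∩ B).Nonempty := ⟨y, this⟩
          rw [Set.nonempty_iff_ne_empty] at hne'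
          exact hne' ((Set.ncard_eq_zero (hAfin.subset Set.inter_subset_left)).1 hdisj)
        · exact h
      -- two points of `A` span `A`
      have hA2 : 2 ≤ (A \ {x}).ncard := by
        have := Set.ncard_sdiff_singleton_add_one hxA hAfin; omega
      have hrA2 : (2 : ℕ∞) ≤ M.eRk (A \ {x}) :=
        two_le_eRk_of_two_le_ncard_of_free M hfree (Set.sdiff_subset.trans (hAP.trans hP)) hA2
      have hAcl : A ⊆ M.closure (A \ {x}) :=
        subset_closure_of_eRk_le M Set.sdiff_subset (hAP.trans hP) hAfin (hrA.trans hrA2)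
      have hxcl : x ∈ M.closure H' := M.closure_subset_closure hsub (hAcl hxA)
      exact notMem_closure_of_gclosed hH'cl hxP hxH' hxcl
    -- so `m` meets `A` and `B` in `≤ 1` point each: `|m| ≤ 2`
    have h1 := ncard_inter_le_one_of_lines M hfree hP hm hA hrm hrA hm3 hA3' hmA
    have h2 := ncard_inter_le_one_of_lines M hfree hP hm hB hrm hrB hm3 hB3' hmB
    have hmsplit : m ⊆ (m ∩ A) ∪ (m ∩ B) := by
      intro y hy
      rcases hcov (hm.1 hy) with h | h
      · exact Or.inl ⟨hy, h⟩
      · exact Or.inr ⟨hy, h⟩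
    have hmfin : m.Finite := hPfin.subset hm.1
    have : m.ncard ≤ (m ∩ A).ncard + (m ∩ B).ncard :=
      (Set.ncard_le_ncard hmsplit ((hmfin.subset Set.inter_subset_left).union
        (hmfin.subset Set.inter_subset_left))).trans (Set.ncard_union_le _ _)
    omega
  -- one of the two sides has `3` points
  rcases Nat.lt_or_ge H₁.ncard 3 with hlt | hge
  · have hH₂3' : H₂.ncard = 3 := by omega
    have hcovm : P \ {x} ⊆ H₂ ∪ (if H₂ = H₁ then H₂ else H₁) := by
      by_cases h : H₂ = H₁
      · simp only [if_pos h]; rw [h, Set.union_self]; rw [h] at hcov'; simpa using hcov'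
      · simp only [if_neg h]; rw [Set.union_comm]; exact hcov'
    exact hside H₂ hH₂ hxH₂ hrH₂ hH₂3' hcovm
  · have hH₁3' : H₁.ncard = 3 := by omega
    have hcovm : P \ {x} ⊆ H₁ ∪ (if H₁ = H₁ then H₂ else H₁) := by simp only [if_true]; exact hcov'
    exact hside H₁ hH₁ hxH₁ hrH₁ hH₁3' hcovm

end ThmN

end PercRepro
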